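import Mathlib.Algebra.MonoidAlgebra.Basic
import Mathlib.Algebra.MonoidAlgebra.MapDomain
import Mathlib.Algebra.MonoidAlgebra.Module
import Mathlib.RingTheory.Adjoin.Basic
import Mathlib.RingTheory.FiniteType
import HarnessLib

/-!
# Toric surface programme: `k[σ∨ ∩ ℤ²]` is a direct summand of the polynomial ring `k[ℕ²]`

Support file for crux stmt-ResolutionOfSingularities-15317 (`FrobeniusLadder.FRationalResolution`),
line `redirect`, lead c4 (toric surface programme: all affine toric surfaces
`U(r,a) = Spec k[{m ∈ ℤ² : 0 ≤ m₂, a m₂ ≤ r m₁}]` over every field lie in the crux's residual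
class — direct summands of regular rings have every ideal tightly closed — and are resolved by the
Hirzebruch–Jung tower).

This file: for `1 ≤ r` the toric surface algebra `TA[r, a] = k[σS[r, a]] ⊆ k[ℤ²]` is a DIRECT
SUMMAND of the polynomial ring `TA[1, 0] = k[ℕ²]`, in the concrete form of an injective ring map
`Λ : TA[r, a] → TA[1, 0]` together with an additive retraction `ρ : TA[1, 0] → TA[r, a]`,
`ρ ∘ Λ = id`, that is `TA[r, a]`-linear through `Λ` (`ρ (Λ t · g) = t · ρ g`). The construction is
on EXPONENTS and valid in every characteristic (no group action, no Reynolds operator): the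
injective lattice map `λ(m₁, m₂) = (m₂, r m₁ − a m₂)` (determinant `−r ≠ 0`) satisfies
`m ∈ σS[r, a] ↔ λ m ∈ σS[1, 0] = ℕ²`, so pushing monomials forward along `λ`
(`AddMonoidAlgebra.mapDomainRingHom`) maps `TA[r, a]` into `TA[1, 0]`, and pulling coefficients
back along `λ` (`AddMonoidAlgebra.comapDomain`, which kills the monomials whose exponent is not in
the sublattice `λ(ℤ²)`) maps `TA[1, 0]` back into `TA[r, a]`, is a left inverse of the
push-forward, and is linear over it because `λ(ℤ²)` is a subgroup.

* `toricRetract_cone_add_mem` — `σS[r, a]` is closed under addition;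
* `toricRetract_mem_iff` — `f ∈ TA[r, a] ↔` every exponent of `f` lies in `σS[r, a]`
  (`Algebra.adjoin_eq_span_of_subset` + `AddMonoidAlgebra.supported_eq_span_single`: the
  monomials of a submonoid span their own algebra);
* `toricRetract_comap_map`, `toricRetract_comap_map_mul` — `π (L f) = f` and
  `π (L f · g) = f · π g` for `L = mapDomain λ`, `π = comapDomain λ`, `λ` injective additive;
* `stub_toric_retract` — the registered stub.

All folklore (Hochster 1972, §1; Bruns–Herzog 1993, Ex. 6.1.10; Cox–Little–Schenck 2011, §1.3);
no published fact is used and no definition is introduced (the lattice map is an inline term).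
Pure commutative algebra: only Mathlib is imported (the registered statement elaborates to the
same term as in the skeleton's scheme-theoretic context — checked with `pp.all`).
-/

set_option linter.dupNamespace false

noncomputable section

namespace Summit.ResolutionOfSingularities.ResolutionOfSingularities.Theorems.FRationalResolution

section Toric

variable (k : Type) [Field k]

/-- The Laurent polynomial ring `k[ℤ²]` (coordinate ring of the 2-torus). -/
local notation3 "Lk" => AddMonoidAlgebra k (ℤ × ℤ)

/-- The lattice points of the dual cone `σ∨ = {m₂ ≥ 0, a m₂ ≤ r m₁}` of `σ = cone((0,1),(r,-a))`. -/
local notation3 "σS[" r ", " a "]" =>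
  {m : ℤ × ℤ | 0 ≤ m.2 ∧ ((a : ℕ) : ℤ) * m.2 ≤ ((r : ℕ) : ℤ) * m.1}

/-- The toric surface algebra `k[σ∨ ∩ ℤ²] ⊆ k[ℤ²]`. -/
local notation3 "TA[" r ", " a "]" =>
  Algebra.adjoin k ((fun m : ℤ × ℤ => AddMonoidAlgebra.single m (1 : k)) '' σS[r, a])

/-- The lattice points `σS[r, a] = {0 ≤ m₂, a m₂ ≤ r m₁}` of the dual cone are closed under
addition. [folklore] -/
theorem toricRetract_cone_add_mem (r a : ℕ) {m n : ℤ × ℤ} (hm : m ∈ σS[r, a])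
    (hn : n ∈ σS[r, a]) : m + n ∈ σS[r, a] := by
  simp only [Set.mem_setOf_eq, Prod.snd_add, Prod.fst_add] at hm hn ⊢
  refine ⟨add_nonneg hm.1 hn.1, ?_⟩
  rw [mul_add, mul_add]
  exact add_le_add hm.2 hn.2

/-- **Exponent description of the toric algebra**: a Laurent polynomial `f ∈ k[ℤ²]` lies in
`TA[r, a] = k[σS[r, a]]` iff every exponent in its support lies in the cone `σS[r, a]`. Since the
monomials `χᵐ`, `m ∈ σS[r, a]`, contain `1 = χ⁰` and are closed under multiplication
(`toricRetract_cone_add_mem`), the subalgebra they generate is their `k`-span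
(`Algebra.adjoin_eq_span_of_subset`), which is the submodule of elements supported on `σS[r, a]`
(`AddMonoidAlgebra.supported_eq_span_single`). [folklore; Cox–Little–Schenck 2011, §1.3] -/
theorem toricRetract_mem_iff (r a : ℕ) (f : Lk) :
    f ∈ TA[r, a] ↔ ∀ n ∈ f.coeff.support, n ∈ σS[r, a] := by
  have key : Subalgebra.toSubmodule TA[r, a] = AddMonoidAlgebra.supported k k σS[r, a] := by
    rw [AddMonoidAlgebra.supported_eq_span_single]
    apply Algebra.adjoin_eq_span_of_subset
    -- the generating monomials (with `1`) form a submonoid, so their monoid closure adds nothing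
    let S' : Submonoid Lk :=
      { carrier := (fun m : ℤ × ℤ => AddMonoidAlgebra.single m (1 : k)) '' σS[r, a]
        mul_mem' := by
          rintro _ _ ⟨m, hm, rfl⟩ ⟨n, hn, rfl⟩
          exact ⟨m + n, toricRetract_cone_add_mem r a hm hn,
            by simp [AddMonoidAlgebra.single_mul_single]⟩
        one_mem' := ⟨0, by simp, by simp [AddMonoidAlgebra.one_def]⟩ }
    have hle : Submonoid.closure ((fun m : ℤ × ℤ => AddMonoidAlgebra.single m (1 : k)) ''
        σS[r, a]) ≤ S' := Submonoid.closure_le.2 fun x hx => hx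
    exact fun x hx => Submodule.subset_span (hle hx)
  rw [← Subalgebra.mem_toSubmodule, key, AddMonoidAlgebra.mem_supported]
  exact Iff.rfl

/-- For an injective additive map `λ` of the exponent lattice `ℤ²`, pulling coefficients back
along `λ` (`AddMonoidAlgebra.comapDomain λ`) is a left inverse of pushing monomials forward
(`AddMonoidAlgebra.mapDomain λ`): `π (L f) = f`. [folklore] -/
theorem toricRetract_comap_map (lam : ℤ × ℤ →+ ℤ × ℤ) (hlam : Function.Injective lam) (f : Lk) :
    AddMonoidAlgebra.comapDomain lam hlam (AddMonoidAlgebra.mapDomain lam f) = f := by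
  ext n
  simp [Finsupp.mapDomain_apply hlam]

/-- For an injective additive map `λ` of the exponent lattice `ℤ²`, the pull-back
`π = AddMonoidAlgebra.comapDomain λ` is linear over the push-forward `L = mapDomain λ`:
`π (L f · g) = f · π g`. On monomials `f = c χᵐ`, `g = d χⁿ`: `L f · g = c d χ^(λ m + n)`, and
`λ m + n ∈ λ(ℤ²) ↔ n ∈ λ(ℤ²)` because `λ(ℤ²)` is a subgroup; if `n = λ n'` both sides are
`c d χ^(m + n')`, otherwise both vanish. [folklore] -/
theorem toricRetract_comap_map_mul (lam : ℤ × ℤ →+ ℤ × ℤ) (hlam : Function.Injective lam)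
    (f g : Lk) :
    AddMonoidAlgebra.comapDomain lam hlam (AddMonoidAlgebra.mapDomain lam f * g) =
      f * AddMonoidAlgebra.comapDomain lam hlam g := by
  induction f using AddMonoidAlgebra.induction_linear with
  | zero => simp
  | add f₁ f₂ h₁ h₂ =>
    rw [AddMonoidAlgebra.mapDomain_add, add_mul, AddMonoidAlgebra.comapDomain_add, h₁, h₂,
      add_mul]
  | single m c =>
    induction g using AddMonoidAlgebra.induction_linear with
    | zero => simp
    | add g₁ g₂ h₁ h₂ =>
      rw [mul_add, AddMonoidAlgebra.comapDomain_add, h₁, h₂, AddMonoidAlgebra.comapDomain_add,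
        mul_add]
    | single n d =>
      rw [AddMonoidAlgebra.mapDomain_single, AddMonoidAlgebra.single_mul_single]
      by_cases hn : n ∈ Set.range lam
      · obtain ⟨n, rfl⟩ := hn
        rw [← map_add, AddMonoidAlgebra.comapDomain_single_map,
          AddMonoidAlgebra.comapDomain_single_map, AddMonoidAlgebra.single_mul_single]
      · have hmn : lam m + n ∉ Set.range lam := by
          rintro ⟨p, hp⟩
          exact hn ⟨p - m, by rw [map_sub, hp, add_sub_cancel_left]⟩
        have h0 : ∀ (q : ℤ × ℤ) (e : k), q ∉ Set.range lam →
            AddMonoidAlgebra.comapDomain lam hlam (AddMonoidAlgebra.single q e) = 0 := by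
          intro q e hq
          ext : 1
          simp [hq]
        rw [h0 _ _ hmn, h0 _ _ hn, mul_zero]

/-- **`k[σ∨ ∩ ℤ²]` is a direct summand of `k[ℕ²]`** (registered stub `stub_toric_retract`, crux
stmt-ResolutionOfSingularities-15317, line `redirect`): for `1 ≤ r` there are an injective ring
map `Λ : TA[r, a] → TA[1, 0] = k[ℕ²]` and an additive retraction `ρ : TA[1, 0] → TA[r, a]` with
`ρ (Λ t) = t` and `ρ (Λ t · g) = t · ρ g`. Take the injective lattice map
`λ(m₁, m₂) = (m₂, r m₁ − a m₂)`, for which `m ∈ σS[r, a] ↔ λ m ∈ σS[1, 0]`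
(`0 ≤ m₂ ∧ a m₂ ≤ r m₁ ↔ 0 ≤ r m₁ − a m₂ ∧ 0 ≤ m₂`); `Λ` is the restriction of the ring map
`L = AddMonoidAlgebra.mapDomainRingHom k λ` of `k[ℤ²]` (it maps `TA[r, a]` into `TA[1, 0]` by the
exponent description `toricRetract_mem_iff`; injective by `AddMonoidAlgebra.mapDomain_injective`),
and `ρ` is the restriction of the coefficient pull-back `π = AddMonoidAlgebra.comapDomain λ` (it
maps `TA[1, 0]` into `TA[r, a]`: an exponent `m` of `π g` has `λ m` an exponent of `g`); the
identities are `toricRetract_comap_map` and `toricRetract_comap_map_mul`.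
[folklore; Hochster 1972 §1, Bruns–Herzog 1993 Ex. 6.1.10] -/
theorem stub_toric_retract (r a : ℕ) (hr : 1 ≤ r) :
    ∃ (Λ : ↥TA[r, a] →+* ↥TA[1, 0]) (ρ : ↥TA[1, 0] →+ ↥TA[r, a]), Function.Injective Λ ∧
      (∀ t, ρ (Λ t) = t) ∧ (∀ t g, ρ (Λ t * g) = t * ρ g) := by
  -- the lattice map `λ(m₁, m₂) = (m₂, r m₁ − a m₂)`
  let lam : ℤ × ℤ →+ ℤ × ℤ :=
    { toFun := fun m => (m.2, (r : ℤ) * m.1 - (a : ℤ) * m.2)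
      map_zero' := by simp
      map_add' := fun m n => Prod.ext rfl (by simp only [Prod.fst_add, Prod.snd_add]; ring) }
  have hlam : ∀ m, lam m = (m.2, (r : ℤ) * m.1 - (a : ℤ) * m.2) := fun m => rfl
  have hr' : (0 : ℤ) < (r : ℤ) := by exact_mod_cast hr
  have hinj : Function.Injective lam := by
    intro m n h
    rw [hlam, hlam, Prod.mk.injEq] at h
    obtain ⟨h2, h1⟩ := h
    rw [h2, sub_left_inj] at h1
    exact Prod.ext (mul_left_cancel₀ hr'.ne' h1) h2
  have hmem : ∀ m, m ∈ σS[r, a] ↔ lam m ∈ σS[1, 0] := by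
    intro m
    simp only [Set.mem_setOf_eq, hlam, Nat.cast_zero, zero_mul, Nat.cast_one, one_mul,
      sub_nonneg]
    exact and_comm
  -- push-forward `L` and pull-back `P` along `λ` on `k[ℤ²]`
  have hLmem : ∀ t : ↥TA[r, a], AddMonoidAlgebra.mapDomainRingHom k lam t ∈ TA[1, 0] := by
    intro t
    rw [toricRetract_mem_iff]
    intro n hn
    classical
    rw [AddMonoidAlgebra.mapDomainRingHom_apply, AddMonoidAlgebra.coeff_mapDomain] at hn
    obtain ⟨m, hm, rfl⟩ := Finset.mem_image.1 (Finsupp.mapDomain_support hn)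
    exact (hmem m).1 ((toricRetract_mem_iff k r a (t : Lk)).1 t.2 m hm)
  have hPmem : ∀ g : ↥TA[1, 0],
      AddMonoidAlgebra.comapDomainAddMonoidHom lam hinj g ∈ TA[r, a] := by
    intro g
    rw [toricRetract_mem_iff]
    intro m hm
    rw [AddMonoidAlgebra.comapDomainAddMonoidHom_apply, AddMonoidAlgebra.coeff_comapDomain,
      Finsupp.comapDomain_support, Finset.mem_preimage] at hm
    exact (hmem m).2 ((toricRetract_mem_iff k 1 0 (g : Lk)).1 g.2 _ hm)
  refine ⟨((AddMonoidAlgebra.mapDomainRingHom k lam).comp (TA[r, a]).val.toRingHom).codRestrict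
      (TA[1, 0]) fun t => hLmem t,
    ((AddMonoidAlgebra.comapDomainAddMonoidHom lam hinj).comp
      (AddSubmonoidClass.subtype TA[1, 0])).codRestrict (TA[r, a]) fun g => hPmem g, ?_, ?_, ?_⟩
  · intro s t hst
    have h := congrArg Subtype.val hst
    simp only [RingHom.codRestrict_apply, RingHom.coe_comp, Function.comp_apply,
      AddMonoidAlgebra.mapDomainRingHom_apply] at h
    exact Subtype.ext (AddMonoidAlgebra.mapDomain_injective hinj h)
  · intro t
    apply Subtype.ext
    simp only [AddMonoidHom.codRestrict_apply, AddMonoidHom.coe_comp, Function.comp_apply,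
      AddSubmonoidClass.coe_subtype, RingHom.codRestrict_apply, RingHom.coe_comp,
      AddMonoidAlgebra.mapDomainRingHom_apply, AddMonoidAlgebra.comapDomainAddMonoidHom_apply]
    exact toricRetract_comap_map k lam hinj t
  · intro t g
    apply Subtype.ext
    simp only [AddMonoidHom.codRestrict_apply, AddMonoidHom.coe_comp, Function.comp_apply,
      AddSubmonoidClass.coe_subtype, Subalgebra.coe_mul, RingHom.codRestrict_apply,
      RingHom.coe_comp, AddMonoidAlgebra.mapDomainRingHom_apply,
      AddMonoidAlgebra.comapDomainAddMonoidHom_apply]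
    exact toricRetract_comap_map_mul k lam hinj t g

end Toric

end Summit.ResolutionOfSingularities.ResolutionOfSingularities.Theorems.FRationalResolution

end
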